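import Mathlib.NumberTheory.AbelSummation
import Mathlib.NumberTheory.LSeries.Deriv
import Mathlib.NumberTheory.LSeries.Dirichlet
import Mathlib.NumberTheory.LSeries.HurwitzZetaValues
import Mathlib.NumberTheory.Harmonic.ZetaAsymp
import Mathlib.Analysis.Complex.ExponentialBounds
import Mathlib.Analysis.Real.Pi.Bounds
import Literature.NumberTheory.LFunctions.TuranLiouvilleCriterion
import HarnessLib

/-!
# The Liouville-twisted sections `G_n(σ) = ∑_{ν ≤ n} λ(ν) ν^{-σ}` near `σ = 1` (Turán 1960, §5)

Topic `Literature/NumberTheory/LFunctions` (namespace `Literature.NumberTheory.LFunctions`,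
sub-namespace `TuranLocal`). Everything in this file is PROVED.

These are the arithmetic inputs of §5 of P. Turán, *A theorem on diophantine approximation
with application to Riemann zeta-function*, Acta Sci. Math. (Szeged) 21 (1960), 311–318, where
the Riemann hypothesis is deduced from zero-free half-strips of the sections
`U_n(s) = ∑_{ν ≤ n} ν^{-s}` (the criterion `Literature.Barriers.RiemannHypothesis.Turan1960_criterion`,
discharged in `Literature/Barriers/RiemannHypothesis/TuranPartialSumsLocalProofs.lean`). Turán
(5.3)–(5.7): from "the well-known estimation `|∑_{ν ≤ x} λ(ν)| < x e^{−c₈ √log x}`" and "simple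
properties of `ζ(s)`", the Liouville section `G_n(s) = ∑_{ν ≤ n} λ(ν) ν^{-s}` is controlled near
`s = 1`, and at a real zero `σ₀` of `G_n` near `1` the first Taylor coefficient satisfies
`|d₁| > 1/3` (5.7). We prove the two quantitative statements the argument needs, with the
prime number theorem for `λ` in the every-power-of-`log` form of the tree
(`Literature.NumberTheory.LFunctions.abs_sum_liouville_le_logPow`, PROVED there from the
classical zero-free region):

* `TuranLocal.exists_deriv_lower_bound`: there are `a > 0` and `n₁` such that for all `n ≥ n₁`
  and all real `σ ∈ (1, 1 + a]`,
  `G_n'(σ) = −∑_{ν ≤ n} λ(ν) log ν · ν^{−σ} ≥ 1` (Turán's (5.7), `|d₁| > 1/3`, in a uniform form: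
  the full series is `Φ'(σ)`, `Φ(s) = ζ(2s)/ζ(s)`, and `Φ'(1) = ζ(2) = π²/6`; the tail beyond `n`
  is `O(1/log n)` uniformly in `σ ≥ 1` by partial summation from the prime number theorem for
  `λ`).
* `TuranLocal.exists_lower_bound`: there is `C` with
  `G_n(σ) ≥ (σ − 1)/2 − C/log n` for all `n ≥ 3` and `σ ∈ (1, 2]` (the full series is
  `ζ(2σ)/ζ(σ) ≥ 1/ζ(σ) ≥ (σ − 1)/σ`, Titchmarsh (2.1.4) on the real axis; the tail is again
  `O(1/log n)`), so that `G_n(σ) > 0` for `σ ≥ 1 + 2C/log n + …`.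

## Proof sketch

Abel summation (Mathlib's `sum_mul_eq_sub_sub_integral_mul'`) with the summatory function
`B(x) = ∑_{ν ≤ x} λ(ν)`, `|B(x)| ≤ C x/log³ x` (`x ≥ 2`): for `f(t) = t^{−σ}` or
`f(t) = log t · t^{−σ}`, `1 ≤ σ ≤ 2`, one has `|f(t)| ≤ log t/t`, `|f'(t)| ≤ 3 log t/t²` on `t ≥ 3`,
so `|∑_{n < ν ≤ m} f(ν) λ(ν)| ≤ 2C/log² n + 3C ∫_n^m dt/(t log² t) ≤ 5C/log n`
(`TuranLocal.abs_sum_Ioc_mul_liouville_le`). The full series are identified through the tree's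
`(∑ λ(n) n^{-s}) ζ(s) = ζ(2s)` (`TuranLiouville.LSeries_liouville_mul_riemannZeta`), Mathlib's
entire `riemannZeta₁` (`ζ(s) = ζ₁(s)/(s − 1)`), and term-wise differentiation of `L`-series
(`LSeries_hasDerivAt`): `∑ λ(ν) ν^{−σ} = Φ(σ)` and `∑ λ(ν) log ν ν^{−σ} = −Φ'(σ)` for `σ > 1`,
where `Φ(s) = ζ(2s)(s − 1)/ζ₁(s)` is holomorphic near `s = 1` with `Φ(1) = 0`, `Φ'(1) = ζ(2)`.

## References

* [Turan1960] P. Turán, loc. cit., §5, (5.3)–(5.7) (read: Szeged archive copy, pp. 317–318).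
* [Titchmarsh1986] E. C. Titchmarsh, *The Theory of the Riemann Zeta-function*, 2nd ed., §1.2
  (1.2.11) (`ζ(2s)/ζ(s) = ∑ λ(n) n^{-s}`), §2.1 (2.1.4) (`ζ` on the real axis).
-/

noncomputable section

open Complex Filter Set MeasureTheory ArithmeticFunction Finset
open scoped Topology

namespace Literature.NumberTheory.LFunctions

namespace TuranLocal

/-! ### Partial summation against the prime number theorem for `λ` -/

/-- `∫_a^b dt/(t log² t) = 1/log a − 1/log b` for `2 ≤ a ≤ b` (antiderivative `−1/log t`).
[folklore] -/
theorem integral_inv_mul_inv_log_sq {a b : ℝ} (ha : 2 ≤ a) (hab : a ≤ b) :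
    ∫ t in a..b, t⁻¹ / Real.log t ^ 2 = (Real.log a)⁻¹ - (Real.log b)⁻¹ := by
  have hderiv : ∀ t ∈ Set.uIcc a b, HasDerivAt (fun t ↦ -(Real.log t)⁻¹) (t⁻¹ / Real.log t ^ 2) t := by
    intro t ht
    rw [Set.uIcc_of_le hab] at ht
    have ht0 : 0 < t := by linarith [ht.1]
    have hlog : Real.log t ≠ 0 := (Real.log_pos (by linarith [ht.1])).ne'
    have h1 : HasDerivAt (fun t ↦ (Real.log t)⁻¹) (-(t⁻¹) / Real.log t ^ 2) t :=
      (Real.hasDerivAt_log ht0.ne').inv hlog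
    have h2 := h1.neg
    rw [show t⁻¹ / Real.log t ^ 2 = -(-(t⁻¹) / Real.log t ^ 2) by ring]
    exact h2
  have hcont : ContinuousOn (fun t : ℝ ↦ t⁻¹ / Real.log t ^ 2) (Set.uIcc a b) := by
    rw [Set.uIcc_of_le hab]
    refine ContinuousOn.div (continuousOn_inv₀.mono ?_) ((Real.continuousOn_log.mono ?_).pow 2) ?_
    · intro t ht; exact ne_of_gt (by linarith [ht.1] : (0 : ℝ) < t)
    · intro t ht; exact ne_of_gt (by linarith [ht.1] : (0 : ℝ) < t)
    · intro t ht; exact pow_ne_zero 2 (Real.log_pos (by linarith [ht.1])).ne'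
  rw [intervalIntegral.integral_eq_sub_of_hasDerivAt hderiv (hcont.intervalIntegrable)]
  ring

/-- The summatory function `B(x) = ∑_{ν ≤ x} λ(ν)` in Mathlib's Abel-summation format
(`∑_{k ∈ Icc 0 ⌊x⌋} λ(k)`, `λ(0) = 0`). [folklore] -/
theorem sum_Icc_zero_liouville (x : ℝ) :
    ∑ k ∈ Icc 0 ⌊x⌋₊, (liouville k : ℝ) = ∑ k ∈ Ioc 0 ⌊x⌋₊, (liouville k : ℝ) := by
  rw [Icc_eq_cons_Ioc (Nat.zero_le _), sum_cons]
  simp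

/-- **Partial summation against the prime number theorem for `λ`.** There is an absolute `C`
such that for `3 ≤ n ≤ m` and every `f` with `|f(t)| ≤ log t/t`, `|f'(t)| ≤ 3 log t/t²` on `[n, m]`,
`|∑_{n < ν ≤ m} f(ν) λ(ν)| ≤ C/log n`. (Abel summation with `|∑_{ν ≤ x} λ(ν)| ≤ C₀ x/log³ x`.)
[cite: Turan1960, §5 (5.3)–(5.4)] -/
theorem abs_sum_Ioc_mul_liouville_le :
    ∃ C : ℝ, 0 ≤ C ∧ ∀ (n m : ℕ), 3 ≤ n → n ≤ m → ∀ (f f' : ℝ → ℝ),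
      (∀ t ∈ Set.Icc (n : ℝ) m, HasDerivAt f (f' t) t) → ContinuousOn f' (Set.Icc (n : ℝ) m) →
      (∀ t ∈ Set.Icc (n : ℝ) m, |f t| ≤ Real.log t / t) →
      (∀ t ∈ Set.Icc (n : ℝ) m, |f' t| ≤ 3 * Real.log t / t ^ 2) →
      |∑ k ∈ Ioc n m, f k * (liouville k : ℝ)| ≤ C / Real.log n := by
  obtain ⟨C₀, hC₀⟩ := abs_sum_liouville_le_logPow 3
  set C : ℝ := max C₀ 0 with hC
  have hC0 : 0 ≤ C := le_max_right _ _
  have hB : ∀ x : ℝ, 2 ≤ x → |∑ k ∈ Icc 0 ⌊x⌋₊, (liouville k : ℝ)| ≤ C * x / Real.log x ^ 3 := by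
    intro x hx
    rw [sum_Icc_zero_liouville]
    have h := hC₀ x hx
    have hlog : 0 < Real.log x := Real.log_pos (by linarith)
    have hx0 : (0 : ℝ) ≤ x := by linarith
    have hr : Real.log x ^ (3 : ℝ) = Real.log x ^ (3 : ℕ) := by
      rw [show (3 : ℝ) = ((3 : ℕ) : ℝ) by norm_num, Real.rpow_natCast]
    rw [hr] at h
    refine h.trans ?_
    exact div_le_div_of_nonneg_right (mul_le_mul_of_nonneg_right (le_max_left C₀ 0) hx0)
      (pow_nonneg hlog.le 3)
  refine ⟨5 * C, by positivity, fun n m hn hnm f f' hf hf' hfb hf'b ↦ ?_⟩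
  have hn3 : (3 : ℝ) ≤ n := by exact_mod_cast hn
  have hnm' : (n : ℝ) ≤ m := by exact_mod_cast hnm
  have hlog3 : 1 < Real.log 3 := by
    rw [← Real.exp_lt_exp, Real.exp_log (by norm_num)]
    exact lt_trans Real.exp_one_lt_d9 (by norm_num)
  have hlogn : 1 < Real.log n := hlog3.trans_le (Real.log_le_log (by norm_num) hn3)
  have hlogt : ∀ t : ℝ, (n : ℝ) ≤ t → 1 < Real.log t := fun t ht ↦
    hlogn.trans_le (Real.log_le_log (by linarith) ht)
  -- `deriv f = f'` on `[n, m]`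
  have hderiv : ∀ t ∈ Set.Icc (n : ℝ) m, deriv f t = f' t := fun t ht ↦ (hf t ht).deriv
  have hdiff : ∀ t ∈ Set.Icc (n : ℝ) m, DifferentiableAt ℝ f t := fun t ht ↦ (hf t ht).differentiableAt
  have hint : IntegrableOn (deriv f) (Set.Icc (n : ℝ) m) :=
    (hf'.integrableOn_Icc).congr_fun (fun t ht ↦ (hderiv t ht).symm) measurableSet_Icc
  -- Abel summation
  rw [sum_mul_eq_sub_sub_integral_mul' (fun k ↦ (liouville k : ℝ)) hnm hdiff hint]
  -- boundary terms
  have hbd : ∀ x : ℝ, (n : ℝ) ≤ x → x ∈ Set.Icc (n : ℝ) m →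
      |f x * ∑ k ∈ Icc 0 ⌊x⌋₊, (liouville k : ℝ)| ≤ C / Real.log n := by
    intro x hx hxm
    have hx2 : 2 ≤ x := by linarith
    have hx0 : 0 < x := by linarith
    have hlx := hlogt x hx
    rw [abs_mul]
    calc |f x| * |∑ k ∈ Icc 0 ⌊x⌋₊, (liouville k : ℝ)| ≤ (Real.log x / x) * (C * x / Real.log x ^ 3) :=
          mul_le_mul (hfb x hxm) (hB x hx2) (abs_nonneg _)
            (div_nonneg (by linarith) hx0.le)
      _ = C / Real.log x ^ 2 := by field_simp
      _ ≤ C / Real.log x := by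
          apply div_le_div_of_nonneg_left hC0 (by linarith)
          nlinarith
      _ ≤ C / Real.log n :=
          div_le_div_of_nonneg_left hC0 (by linarith) (Real.log_le_log (by linarith) hx)
  have h1 := hbd m hnm' ⟨hnm', le_rfl⟩
  have h2 := hbd n le_rfl ⟨le_rfl, hnm'⟩
  -- the integral term
  have h3 : |∫ t in Set.Ioc (n : ℝ) m, deriv f t * ∑ k ∈ Icc 0 ⌊t⌋₊, (liouville k : ℝ)| ≤
      3 * C / Real.log n := by
    have hg_cont : ContinuousOn (fun t : ℝ ↦ 3 * C * (t⁻¹ / Real.log t ^ 2)) (Set.Icc (n : ℝ) m) := by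
      refine continuousOn_const.mul (ContinuousOn.div (continuousOn_inv₀.mono ?_)
        ((Real.continuousOn_log.mono ?_).pow 2) ?_)
      · intro t ht; exact ne_of_gt (by linarith [ht.1] : (0 : ℝ) < t)
      · intro t ht; exact ne_of_gt (by linarith [ht.1] : (0 : ℝ) < t)
      · intro t ht; exact pow_ne_zero 2 (by linarith [hlogt t ht.1] : Real.log t ≠ 0)
    have hg_int : IntegrableOn (fun t : ℝ ↦ 3 * C * (t⁻¹ / Real.log t ^ 2)) (Set.Ioc (n : ℝ) m) :=
      hg_cont.integrableOn_Icc.mono_set Set.Ioc_subset_Icc_self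
    have hbound : ∀ᵐ t ∂(volume.restrict (Set.Ioc (n : ℝ) m)),
        ‖deriv f t * ∑ k ∈ Icc 0 ⌊t⌋₊, (liouville k : ℝ)‖ ≤ 3 * C * (t⁻¹ / Real.log t ^ 2) := by
      filter_upwards [ae_restrict_mem measurableSet_Ioc] with t ht
      have htI : t ∈ Set.Icc (n : ℝ) m := ⟨ht.1.le, ht.2⟩
      have ht2 : 2 ≤ t := by linarith [ht.1]
      have ht0 : 0 < t := by linarith [ht.1]
      have hlt := hlogt t ht.1.le
      rw [Real.norm_eq_abs, abs_mul, hderiv t htI]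
      calc |f' t| * |∑ k ∈ Icc 0 ⌊t⌋₊, (liouville k : ℝ)|
          ≤ (3 * Real.log t / t ^ 2) * (C * t / Real.log t ^ 3) :=
            mul_le_mul (hf'b t htI) (hB t ht2) (abs_nonneg _) (by positivity)
        _ = 3 * C * (t⁻¹ / Real.log t ^ 2) := by field_simp
    calc |∫ t in Set.Ioc (n : ℝ) m, deriv f t * ∑ k ∈ Icc 0 ⌊t⌋₊, (liouville k : ℝ)|
        = ‖∫ t in Set.Ioc (n : ℝ) m, deriv f t * ∑ k ∈ Icc 0 ⌊t⌋₊, (liouville k : ℝ)‖ :=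
          (Real.norm_eq_abs _).symm
      _ ≤ ∫ t in Set.Ioc (n : ℝ) m, 3 * C * (t⁻¹ / Real.log t ^ 2) :=
          norm_integral_le_of_norm_le hg_int hbound
      _ = 3 * C * ((Real.log n)⁻¹ - (Real.log m)⁻¹) := by
          rw [← intervalIntegral.integral_of_le hnm', intervalIntegral.integral_const_mul,
            integral_inv_mul_inv_log_sq (by linarith) hnm']
      _ ≤ 3 * C / Real.log n := by
          have : 0 ≤ (Real.log m)⁻¹ := inv_nonneg.2 (by linarith [hlogt m hnm'])
          rw [div_eq_mul_inv]
          nlinarith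
  -- assemble
  have habs : ∀ a b c : ℝ, |a - b - c| ≤ |a| + |b| + |c| := fun a b c ↦ by
    calc |a - b - c| ≤ |a - b| + |c| := abs_sub _ _
      _ ≤ |a| + |b| + |c| := by linarith [abs_sub a b]
  calc |f m * ∑ k ∈ Icc 0 m, (liouville k : ℝ) - f n * ∑ k ∈ Icc 0 n, (liouville k : ℝ) -
        ∫ t in Set.Ioc (n : ℝ) m, deriv f t * ∑ k ∈ Icc 0 ⌊t⌋₊, (liouville k : ℝ)|
      ≤ |f m * ∑ k ∈ Icc 0 m, (liouville k : ℝ)| + |f n * ∑ k ∈ Icc 0 n, (liouville k : ℝ)| +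
        |∫ t in Set.Ioc (n : ℝ) m, deriv f t * ∑ k ∈ Icc 0 ⌊t⌋₊, (liouville k : ℝ)| := habs _ _ _
    _ ≤ C / Real.log n + C / Real.log n + 3 * C / Real.log n := by
        gcongr
        · simpa using h1
        · simpa using h2
    _ = 5 * C / Real.log n := by ring

/-- **The two tails** `∑_{n < ν ≤ m} λ(ν) ν^{−σ}` and `∑_{n < ν ≤ m} λ(ν) log ν · ν^{−σ}` are
`O(1/log n)` uniformly in `m ≥ n ≥ 3` and `1 ≤ σ ≤ 2` (the previous lemma with `f(t) = t^{−σ}`,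
resp. `f(t) = log t · t^{−σ}`). [cite: Turan1960, §5 (5.3)–(5.4)] -/
theorem abs_tails_le :
    ∃ C : ℝ, 0 ≤ C ∧ ∀ (n m : ℕ), 3 ≤ n → n ≤ m → ∀ σ : ℝ, 1 ≤ σ → σ ≤ 2 →
      |∑ k ∈ Ioc n m, (k : ℝ) ^ (-σ) * (liouville k : ℝ)| ≤ C / Real.log n ∧
      |∑ k ∈ Ioc n m, (Real.log k * (k : ℝ) ^ (-σ)) * (liouville k : ℝ)| ≤ C / Real.log n := by
  obtain ⟨C, hC0, hC⟩ := abs_sum_Ioc_mul_liouville_le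
  refine ⟨C, hC0, fun n m hn hnm σ hσ1 hσ2 ↦ ?_⟩
  have hn3 : (3 : ℝ) ≤ n := by exact_mod_cast hn
  -- facts on `[n, m]`
  have hpos : ∀ t ∈ Set.Icc (n : ℝ) m, 0 < t := fun t ht ↦ by linarith [ht.1]
  have hone : ∀ t ∈ Set.Icc (n : ℝ) m, 1 ≤ t := fun t ht ↦ by linarith [ht.1]
  have hlog1 : ∀ t ∈ Set.Icc (n : ℝ) m, 1 ≤ Real.log t := fun t ht ↦
    LiouvilleSum.one_le_log (by linarith [ht.1])
  -- `t^{-σ} ≤ 1/t` and `t^{-σ-1} ≤ 1/t²`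
  have hrpow1 : ∀ t ∈ Set.Icc (n : ℝ) m, t ^ (-σ) ≤ t⁻¹ := fun t ht ↦ by
    rw [← Real.rpow_neg_one]
    exact Real.rpow_le_rpow_of_exponent_le (hone t ht) (by linarith)
  have hrpow2 : ∀ t ∈ Set.Icc (n : ℝ) m, t ^ (-σ - 1) ≤ (t ^ 2)⁻¹ := fun t ht ↦ by
    have : (t ^ 2)⁻¹ = t ^ (-2 : ℝ) := by
      rw [Real.rpow_neg (hpos t ht).le, show (2 : ℝ) = ((2 : ℕ) : ℝ) by norm_num, Real.rpow_natCast]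
    rw [this]
    exact Real.rpow_le_rpow_of_exponent_le (hone t ht) (by linarith)
  constructor
  · -- `f(t) = t^{-σ}`
    refine hC n m hn hnm (fun t ↦ t ^ (-σ)) (fun t ↦ -σ * t ^ (-σ - 1)) (fun t ht ↦ ?_) ?_
      (fun t ht ↦ ?_) (fun t ht ↦ ?_)
    · exact Real.hasDerivAt_rpow_const (Or.inl (hpos t ht).ne')
    · exact continuousOn_const.mul (continuousOn_id.rpow_const fun t ht ↦ Or.inl (hpos t ht).ne')
    · rw [abs_of_nonneg (Real.rpow_nonneg (hpos t ht).le _)]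
      refine (hrpow1 t ht).trans ?_
      rw [inv_eq_one_div, div_le_div_iff_of_pos_right (hpos t ht)]
      exact hlog1 t ht
    · rw [abs_mul, abs_neg, abs_of_nonneg (by linarith : (0 : ℝ) ≤ σ),
        abs_of_nonneg (Real.rpow_nonneg (hpos t ht).le _)]
      have ht2 : 0 < t ^ 2 := pow_pos (hpos t ht) 2
      calc σ * t ^ (-σ - 1) ≤ 2 * (t ^ 2)⁻¹ :=
            mul_le_mul hσ2 (hrpow2 t ht) (Real.rpow_nonneg (hpos t ht).le _) (by norm_num)
        _ ≤ 3 * Real.log t / t ^ 2 := by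
            rw [le_div_iff₀ ht2, mul_assoc, inv_mul_cancel₀ ht2.ne', mul_one]
            linarith [hlog1 t ht]
  · -- `f(t) = log t · t^{-σ}`
    refine hC n m hn hnm (fun t ↦ Real.log t * t ^ (-σ))
      (fun t ↦ t⁻¹ * t ^ (-σ) + Real.log t * (-σ * t ^ (-σ - 1))) (fun t ht ↦ ?_) ?_
      (fun t ht ↦ ?_) (fun t ht ↦ ?_)
    · exact (Real.hasDerivAt_log (hpos t ht).ne').mul
        (Real.hasDerivAt_rpow_const (Or.inl (hpos t ht).ne'))
    · have h1 : ContinuousOn (fun t : ℝ ↦ t ^ (-σ)) (Set.Icc (n : ℝ) m) :=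
        continuousOn_id.rpow_const fun t ht ↦ Or.inl (hpos t ht).ne'
      have h2 : ContinuousOn (fun t : ℝ ↦ t ^ (-σ - 1)) (Set.Icc (n : ℝ) m) :=
        continuousOn_id.rpow_const fun t ht ↦ Or.inl (hpos t ht).ne'
      have h3 : ContinuousOn (fun t : ℝ ↦ t⁻¹) (Set.Icc (n : ℝ) m) :=
        continuousOn_inv₀.mono fun t ht ↦ (hpos t ht).ne'
      have h4 : ContinuousOn Real.log (Set.Icc (n : ℝ) m) :=
        Real.continuousOn_log.mono fun t ht ↦ (hpos t ht).ne'
      exact (h3.mul h1).add (h4.mul (continuousOn_const.mul h2))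
    · rw [abs_mul, abs_of_nonneg (by linarith [hlog1 t ht] : (0 : ℝ) ≤ Real.log t),
        abs_of_nonneg (Real.rpow_nonneg (hpos t ht).le _), div_eq_mul_inv]
      exact mul_le_mul_of_nonneg_left (hrpow1 t ht) (by linarith [hlog1 t ht])
    · have ht0 := hpos t ht
      have ht2 : 0 < t ^ 2 := by positivity
      have hl := hlog1 t ht
      have hA : |t⁻¹ * t ^ (-σ)| ≤ (t ^ 2)⁻¹ := by
        rw [abs_mul, abs_of_nonneg (inv_nonneg.2 ht0.le), abs_of_nonneg (Real.rpow_nonneg ht0.le _),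
          sq, mul_inv]
        exact mul_le_mul_of_nonneg_left (hrpow1 t ht) (inv_nonneg.2 ht0.le)
      have hB : |Real.log t * (-σ * t ^ (-σ - 1))| ≤ Real.log t * (2 * (t ^ 2)⁻¹) := by
        rw [abs_mul, abs_of_nonneg (by linarith : (0 : ℝ) ≤ Real.log t), abs_mul, abs_neg,
          abs_of_nonneg (by linarith : (0 : ℝ) ≤ σ), abs_of_nonneg (Real.rpow_nonneg ht0.le _)]
        refine mul_le_mul_of_nonneg_left ?_ (by linarith)
        exact mul_le_mul hσ2 (hrpow2 t ht) (Real.rpow_nonneg ht0.le _) (by norm_num)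
      calc |t⁻¹ * t ^ (-σ) + Real.log t * (-σ * t ^ (-σ - 1))|
          ≤ |t⁻¹ * t ^ (-σ)| + |Real.log t * (-σ * t ^ (-σ - 1))| := abs_add_le _ _
        _ ≤ (t ^ 2)⁻¹ + Real.log t * (2 * (t ^ 2)⁻¹) := add_le_add hA hB
        _ = (1 + 2 * Real.log t) / t ^ 2 := by field_simp
        _ ≤ 3 * Real.log t / t ^ 2 := by
            apply div_le_div_of_nonneg_right _ ht2.le
            linarith

/-! ### The full series: summability and the tails of the infinite sums -/

/-- `∑ λ(k) k^{−σ}` converges absolutely for `σ > 1`. [folklore] -/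
theorem summable_rpow_mul_liouville {σ : ℝ} (hσ : 1 < σ) :
    Summable fun k : ℕ ↦ (k : ℝ) ^ (-σ) * (liouville k : ℝ) := by
  refine Summable.of_norm_bounded (g := fun k : ℕ ↦ (k : ℝ) ^ (-σ))
    (Real.summable_nat_rpow.2 (by linarith)) fun k ↦ ?_
  rw [Real.norm_eq_abs, abs_mul, abs_of_nonneg (Real.rpow_nonneg (Nat.cast_nonneg k) _)]
  calc (k : ℝ) ^ (-σ) * |(liouville k : ℝ)| ≤ (k : ℝ) ^ (-σ) * 1 :=
        mul_le_mul_of_nonneg_left (LiouvilleSum.abs_liouville_le_one k)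
          (Real.rpow_nonneg (Nat.cast_nonneg k) _)
    _ = (k : ℝ) ^ (-σ) := mul_one _

/-- `∑ λ(k) log k · k^{−σ}` converges absolutely for `σ > 1` (`log k ≤ k^ε/ε`). [folklore] -/
theorem summable_log_rpow_mul_liouville {σ : ℝ} (hσ : 1 < σ) :
    Summable fun k : ℕ ↦ (Real.log k * (k : ℝ) ^ (-σ)) * (liouville k : ℝ) := by
  set ε : ℝ := (σ - 1) / 2 with hε
  have hε0 : 0 < ε := by rw [hε]; linarith
  refine Summable.of_norm_bounded (g := fun k : ℕ ↦ ε⁻¹ * (k : ℝ) ^ (ε - σ))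
    ((Real.summable_nat_rpow.2 (by rw [hε]; linarith)).mul_left _) fun k ↦ ?_
  have hk0 : (0 : ℝ) ≤ k := Nat.cast_nonneg k
  rw [Real.norm_eq_abs, abs_mul, abs_mul, abs_of_nonneg (Real.rpow_nonneg hk0 _)]
  rcases Nat.eq_zero_or_pos k with rfl | hk
  · simp [Real.zero_rpow (by linarith : (ε : ℝ) - σ ≠ 0)]
  · have hk' : (0 : ℝ) < k := by exact_mod_cast hk
    have hlogk : 0 ≤ Real.log k := Real.log_nonneg (by exact_mod_cast hk)
    rw [abs_of_nonneg hlogk]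
    have h1 : Real.log k ≤ (k : ℝ) ^ ε / ε := Real.log_le_rpow_div hk0 hε0
    calc Real.log k * (k : ℝ) ^ (-σ) * |(liouville k : ℝ)|
        ≤ Real.log k * (k : ℝ) ^ (-σ) * 1 := by
          refine mul_le_mul_of_nonneg_left (LiouvilleSum.abs_liouville_le_one k) ?_
          exact mul_nonneg hlogk (Real.rpow_nonneg hk0 _)
      _ ≤ ((k : ℝ) ^ ε / ε) * (k : ℝ) ^ (-σ) := by
          rw [mul_one]; exact mul_le_mul_of_nonneg_right h1 (Real.rpow_nonneg hk0 _)
      _ = ε⁻¹ * (k : ℝ) ^ (ε - σ) := by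
          rw [sub_eq_add_neg, Real.rpow_add hk']; ring

/-- Passing a uniform bound on the finite tails to the infinite tail: if `|∑_{n < k ≤ m} g(k)| ≤ K`
for all `m ≥ n` and `g` is summable, then `|∑_{k ≥ 1} g(k) − ∑_{k ≤ n} g(k)| ≤ K` (`g(0) = 0`).
[folklore] -/
theorem abs_tsum_sub_sum_Icc_le {g : ℕ → ℝ} (hg : Summable g) (hg0 : g 0 = 0) {n : ℕ} {K : ℝ}
    (h : ∀ m : ℕ, n ≤ m → |∑ k ∈ Ioc n m, g k| ≤ K) :
    |∑' k, g k - ∑ k ∈ Icc 1 n, g k| ≤ K := by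
  have ht := (hg.tendsto_sum_tsum_nat).comp (tendsto_add_atTop_nat 1)
  have hIcc : ∑ k ∈ Icc 1 n, g k = ∑ k ∈ range (n + 1), g k := by
    rw [Finset.range_eq_Ico, Finset.sum_eq_sum_Ico_succ_bot (by omega : 0 < n + 1), hg0, zero_add,
      zero_add, Finset.Ico_add_one_right_eq_Icc]
  have hu : Tendsto (fun m : ℕ ↦ |∑ k ∈ range (m + 1), g k - ∑ k ∈ Icc 1 n, g k|) atTop
      (𝓝 |∑' k, g k - ∑ k ∈ Icc 1 n, g k|) :=
    (continuous_abs.tendsto _).comp (ht.sub_const _)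
  refine le_of_tendsto hu (eventually_atTop.2 ⟨n, fun m hm ↦ ?_⟩)
  have hsplit : ∑ k ∈ range (m + 1), g k - ∑ k ∈ Icc 1 n, g k = ∑ k ∈ Ioc n m, g k := by
    rw [hIcc, Finset.range_eq_Ico, Finset.range_eq_Ico,
      ← Finset.sum_Ico_consecutive g (Nat.zero_le (n + 1)) (by omega : n + 1 ≤ m + 1),
      Finset.Ico_add_one_add_one_eq_Ioc]
    ring
  rw [hsplit]
  exact h m hm

/-! ### The full series as `L`-series, and `Φ(s) = ζ(2s)(s − 1)/ζ₁(s)` near `s = 1` -/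

/-- The Liouville function as complex Dirichlet coefficients. [folklore] -/
abbrev lam : ℕ → ℂ := fun k ↦ (liouville k : ℂ)

/-- The abscissa of absolute convergence of `∑ λ(n) n^{-s}` is `≤ 1`. [folklore] -/
theorem abscissaOfAbsConv_lam_le : LSeries.abscissaOfAbsConv lam ≤ 1 :=
  LSeries.abscissaOfAbsConv_le_of_le_const ⟨1, fun n _ ↦ TuranLiouville.norm_liouville_le_one n⟩

/-- For real `σ > 1`: `abscissaOfAbsConv λ < Re σ`. [folklore] -/
theorem abscissaOfAbsConv_lam_lt {σ : ℝ} (hσ : 1 < σ) :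
    LSeries.abscissaOfAbsConv lam < ((σ : ℂ).re : EReal) := by
  refine abscissaOfAbsConv_lam_le.trans_lt ?_
  rw [Complex.ofReal_re]
  exact_mod_cast hσ

/-- The `L`-series of `λ` at a real point is the real series `∑ λ(k) k^{−σ}`. [folklore] -/
theorem LSeries_lam_ofReal {σ : ℝ} (hσ : 1 < σ) :
    LSeries lam σ = ((∑' k : ℕ, (k : ℝ) ^ (-σ) * (liouville k : ℝ) : ℝ) : ℂ) := by
  rw [LSeries, Complex.ofReal_tsum]
  refine tsum_congr fun k ↦ ?_
  rcases Nat.eq_zero_or_pos k with rfl | hk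
  · simp [LSeries.term_zero, Real.zero_rpow (by linarith : (-σ : ℝ) ≠ 0)]
  · rw [LSeries.term_of_ne_zero hk.ne', lam]
    have hk0 : (0 : ℝ) ≤ k := Nat.cast_nonneg k
    rw [show (k : ℂ) = ((k : ℝ) : ℂ) by norm_cast, ← Complex.ofReal_cpow hk0, Real.rpow_neg hk0]
    push_cast
    rw [div_eq_mul_inv, mul_comm]

/-- The `L`-series of `log · λ` at a real point is the real series `∑ λ(k) log k · k^{−σ}`.
[folklore] -/
theorem LSeries_logMul_lam_ofReal (σ : ℝ) :
    LSeries (LSeries.logMul lam) σ =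
      ((∑' k : ℕ, (Real.log k * (k : ℝ) ^ (-σ)) * (liouville k : ℝ) : ℝ) : ℂ) := by
  rw [LSeries, Complex.ofReal_tsum]
  refine tsum_congr fun k ↦ ?_
  rcases Nat.eq_zero_or_pos k with rfl | hk
  · simp [LSeries.term_zero]
  · rw [LSeries.term_of_ne_zero hk.ne', LSeries.logMul, lam]
    have hk0 : (0 : ℝ) ≤ k := Nat.cast_nonneg k
    rw [show (k : ℂ) = ((k : ℝ) : ℂ) by norm_cast, ← Complex.ofReal_cpow hk0, Real.rpow_neg hk0,
      ← Complex.ofReal_log hk0]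
    push_cast
    rw [div_eq_mul_inv]
    ring

/-- `Φ(s) = ζ(2s)(s − 1)/ζ₁(s)`, where `ζ₁` is Mathlib's entire completion of `(s − 1)ζ(s)`: equal
to `ζ(2s)/ζ(s) = ∑ λ(n) n^{-s}` on `Re s > 1` and holomorphic near `s = 1`, with `Φ(1) = 0`,
`Φ'(1) = ζ(2)`. [cite: Titchmarsh1986, §1.2 (1.2.11)] -/
def Phi (s : ℂ) : ℂ := riemannZeta (2 * s) * (s - 1) / riemannZeta₁ s

/-- `ζ₁(s) = (s − 1) ζ(s)` for `s ≠ 1`. [folklore] -/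
theorem riemannZeta₁_eq_sub_mul {s : ℂ} (hs : s ≠ 1) : riemannZeta₁ s = (s - 1) * riemannZeta s := by
  rw [riemannZeta_eq_inv_sub_mul hs, ← mul_assoc, mul_inv_cancel₀ (sub_ne_zero.2 hs), one_mul]

/-- **`∑ λ(n) n^{-s} = Φ(s)` for `Re s > 1`** (Titchmarsh (1.2.11), through the tree's
`(∑ λ(n) n^{-s}) ζ(s) = ζ(2s)`). [cite: Titchmarsh1986, §1.2 (1.2.11)] -/
theorem LSeries_lam_eq_Phi {s : ℂ} (hs : 1 < s.re) : LSeries lam s = Phi s := by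
  have hζ : riemannZeta s ≠ 0 := riemannZeta_ne_zero_of_one_lt_re hs
  have hs1 : s ≠ 1 := fun h ↦ by rw [h, Complex.one_re] at hs; exact lt_irrefl _ hs
  have hsub : s - 1 ≠ 0 := sub_ne_zero.2 hs1
  have hζ₁ : riemannZeta₁ s ≠ 0 := by rw [riemannZeta₁_eq_sub_mul hs1]; exact mul_ne_zero hsub hζ
  have hmul := TuranLiouville.LSeries_liouville_mul_riemannZeta hs
  rw [Phi, riemannZeta₁_eq_sub_mul hs1, eq_div_iff (mul_ne_zero hsub hζ)]
  change LSeries lam s * riemannZeta s = riemannZeta (2 * s) at hmul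
  calc LSeries lam s * ((s - 1) * riemannZeta s) = (LSeries lam s * riemannZeta s) * (s - 1) := by ring
    _ = riemannZeta (2 * s) * (s - 1) := by rw [hmul]

/-- The domain `V = {ζ₁ ≠ 0} ∩ {s ≠ 1/2}` on which `Φ` is holomorphic. [folklore] -/
def V : Set ℂ := {s | riemannZeta₁ s ≠ 0 ∧ s ≠ 1 / 2}

/-- `V` is open. [folklore] -/
theorem isOpen_V : IsOpen V :=
  (isOpen_ne_fun differentiable_riemannZeta₁.continuous continuous_const).inter isOpen_ne

/-- `1 ∈ V` (`ζ₁(1) = 1`). [folklore] -/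
theorem one_mem_V : (1 : ℂ) ∈ V := by
  refine ⟨by simp, ?_⟩
  norm_num

/-- `{Re s > 1} ⊆ V`. [folklore] -/
theorem mem_V_of_one_lt_re {s : ℂ} (hs : 1 < s.re) : s ∈ V := by
  have hs1 : s ≠ 1 := fun h ↦ by rw [h, Complex.one_re] at hs; exact lt_irrefl _ hs
  refine ⟨?_, ?_⟩
  · rw [riemannZeta₁_eq_sub_mul hs1]
    exact mul_ne_zero (sub_ne_zero.2 hs1) (riemannZeta_ne_zero_of_one_lt_re hs)
  · intro h; rw [h] at hs; norm_num at hs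

/-- `Φ` is holomorphic on `V`. [folklore] -/
theorem differentiableOn_Phi : DifferentiableOn ℂ Phi V := by
  intro s hs
  have h2s : 2 * s ≠ 1 := by
    intro h; apply hs.2
    have : s = 1 / 2 := by rw [← h]; ring
    exact this
  have h1 : DifferentiableAt ℂ (fun s ↦ riemannZeta (2 * s)) s :=
    (differentiableAt_riemannZeta h2s).comp s (differentiableAt_id.const_mul _)
  have h2 : DifferentiableAt ℂ (fun s : ℂ ↦ s - 1) s := differentiableAt_id.sub_const _
  have h3 : DifferentiableAt ℂ riemannZeta₁ s := differentiable_riemannZeta₁ s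
  exact ((h1.mul h2).div h3 hs.1).differentiableWithinAt

/-- **`Φ'(1) = ζ(2)`** (`Φ = g/ζ₁` with `g(s) = ζ(2s)(s − 1)`, `g(1) = 0`, `g'(1) = ζ(2)`,
`ζ₁(1) = 1`). [folklore] -/
theorem hasDerivAt_Phi_one : HasDerivAt Phi (riemannZeta 2) 1 := by
  have hζ2 : DifferentiableAt ℂ riemannZeta (2 * 1) := differentiableAt_riemannZeta (by norm_num)
  have h1 : HasDerivAt (fun s : ℂ ↦ riemannZeta (2 * s)) (deriv riemannZeta (2 * 1) * 2) 1 := by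
    have hinner : HasDerivAt (fun s : ℂ ↦ 2 * s) 2 1 := by
      simpa using (hasDerivAt_id (1 : ℂ)).const_mul (2 : ℂ)
    exact hζ2.hasDerivAt.comp 1 hinner
  have h2 : HasDerivAt (fun s : ℂ ↦ s - 1) 1 1 := (hasDerivAt_id (1 : ℂ)).sub_const 1
  have h12 := h1.mul h2
  have h3 : HasDerivAt riemannZeta₁ (deriv riemannZeta₁ 1) 1 := (differentiable_riemannZeta₁ 1).hasDerivAt
  have h := h12.div h3 (by simp)
  have heq : ((fun s : ℂ ↦ riemannZeta (2 * s)) * fun s : ℂ ↦ s - 1) / riemannZeta₁ = Phi := by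
    funext s; simp [Phi]
  rw [heq] at h
  exact h.congr_deriv (by simp)

/-- `deriv Φ` is continuous at `1` (`Φ` is holomorphic on the open set `V ∋ 1`). [folklore] -/
theorem continuousAt_deriv_Phi_one : ContinuousAt (deriv Phi) 1 :=
  ((differentiableOn_Phi.analyticOnNhd isOpen_V).deriv.continuousOn).continuousAt
    (isOpen_V.mem_nhds one_mem_V)

/-- **`∑ λ(n) log n · n^{−σ} = −Φ'(σ)` for real `σ > 1`** (term-wise differentiation of the
`L`-series, Mathlib's `LSeries_deriv`, and `L(λ, s) = Φ(s)` on the open half-plane `Re s > 1`).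
[folklore] -/
theorem deriv_Phi_ofReal {σ : ℝ} (hσ : 1 < σ) :
    deriv Phi σ = -LSeries (LSeries.logMul lam) σ := by
  have hσ' : 1 < (σ : ℂ).re := by simpa using hσ
  have hopen : IsOpen {s : ℂ | 1 < s.re} := isOpen_lt continuous_const Complex.continuous_re
  have hev : LSeries lam =ᶠ[𝓝 (σ : ℂ)] Phi :=
    Filter.eventually_of_mem (hopen.mem_nhds hσ') fun s hs ↦ LSeries_lam_eq_Phi hs
  rw [← hev.deriv_eq, LSeries_deriv (abscissaOfAbsConv_lam_lt hσ)]

/-- `1 ≤ Re ζ(x)` for real `x > 1` (the first term of the Dirichlet series; cf. the tree's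
`one_le_re_riemannZeta_ofReal` in `ZetaConvexityExplicit.lean`, reproved here to keep the imports
light). [folklore] -/
theorem one_le_re_riemannZeta_real {x : ℝ} (hx : 1 < x) : 1 ≤ (riemannZeta x).re := by
  have hx' : 1 < (x : ℂ).re := by simpa using hx
  have hsum : Summable fun n : ℕ ↦ 1 / ((n : ℂ) + 1) ^ (x : ℂ) := by
    have := (Complex.summable_one_div_nat_cpow (p := (x : ℂ))).2 hx'
    rw [← summable_nat_add_iff 1] at this
    simpa using this
  have hterm : ∀ n : ℕ, (1 / ((n : ℂ) + 1) ^ (x : ℂ)) = ((((n : ℝ) + 1) ^ x)⁻¹ : ℝ) := by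
    intro n
    have : ((n : ℂ) + 1) = (((n : ℝ) + 1 : ℝ) : ℂ) := by push_cast; ring
    rw [this, ← Complex.ofReal_cpow (by positivity), one_div, Complex.ofReal_inv]
  rw [zeta_eq_tsum_one_div_nat_add_one_cpow hx', Complex.re_tsum hsum]
  simp_rw [hterm, Complex.ofReal_re]
  have hsum' : Summable fun n : ℕ ↦ (((n : ℝ) + 1) ^ x)⁻¹ := by
    have := Complex.reCLM.summable hsum
    refine this.congr fun n ↦ ?_
    simp only [Complex.reCLM_apply, hterm, Complex.ofReal_re]
  calc (1 : ℝ) = ((((0 : ℕ) : ℝ) + 1) ^ x)⁻¹ := by simp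
    _ ≤ ∑' n : ℕ, (((n : ℝ) + 1) ^ x)⁻¹ := hsum'.le_tsum 0 (fun j _ ↦ by positivity)

/-- **The full series is bounded below**: `∑ λ(k) k^{−σ} = ζ(2σ)/ζ(σ) ≥ (σ − 1)/σ` for real
`1 < σ` (`ζ(2σ) ≥ 1` and `0 < ζ(σ) ≤ σ/(σ − 1)`, Titchmarsh (2.1.4) on the real axis).
[cite: Titchmarsh1986, §2.1 (2.1.4)] -/
theorem tsum_rpow_mul_liouville_ge {σ : ℝ} (hσ : 1 < σ) :
    (σ - 1) / σ ≤ ∑' k : ℕ, (k : ℝ) ^ (-σ) * (liouville k : ℝ) := by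
  set L : ℝ := ∑' k : ℕ, (k : ℝ) ^ (-σ) * (liouville k : ℝ) with hL
  have hσ' : 1 < (σ : ℂ).re := by simpa using hσ
  have hmul := TuranLiouville.LSeries_liouville_mul_riemannZeta hσ'
  change LSeries lam σ * riemannZeta σ = riemannZeta (2 * σ) at hmul
  rw [LSeries_lam_ofReal hσ] at hmul
  -- real values of `ζ(σ)` and `ζ(2σ)`
  set z : ℝ := (riemannZeta σ).re with hz
  set w : ℝ := (riemannZeta (2 * σ)).re with hw
  have hzeq : riemannZeta σ = z := by
    apply Complex.ext <;> simp [hz, riemannZeta_im_eq_zero_of_one_lt hσ]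
  have h2σ : 1 < 2 * σ := by linarith
  have hweq : riemannZeta (2 * σ) = w := by
    have : (2 : ℂ) * σ = ((2 * σ : ℝ) : ℂ) := by push_cast; ring
    apply Complex.ext
    · simp [hw]
    · rw [hw, this, Complex.ofReal_im]; exact riemannZeta_im_eq_zero_of_one_lt h2σ
  have hz0 : 0 < z := riemannZeta_re_pos_of_one_lt hσ
  have hw1 : 1 ≤ w := by
    rw [hw, show (2 : ℂ) * σ = ((2 * σ : ℝ) : ℂ) by push_cast; ring]
    exact one_le_re_riemannZeta_real h2σ
  have hzle : z ≤ σ / (σ - 1) := by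
    have h := riemannZeta_ofReal_eq_of_pos (by linarith : 0 < σ) hσ.ne'
    have : z = σ / (σ - 1) - σ * ∫ x in Set.Ioi (1 : ℝ), Int.fract x * x ^ (-(σ + 1)) := by
      rw [hz, h, Complex.ofReal_re]
    rw [this]
    have hI := fractIntegralReal_nonneg σ
    nlinarith
  -- `L z = w`
  have hLz : L * z = w := by
    rw [hzeq, hweq] at hmul
    exact_mod_cast hmul
  have hσ1 : 0 < σ - 1 := by linarith
  have hσ0 : 0 < σ := by linarith
  calc (σ - 1) / σ ≤ 1 / z := by
        rw [div_le_div_iff₀ hσ0 hz0]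
        calc (σ - 1) * z ≤ (σ - 1) * (σ / (σ - 1)) := mul_le_mul_of_nonneg_left hzle hσ1.le
          _ = 1 * σ := by field_simp
    _ ≤ w / z := div_le_div_of_nonneg_right hw1 hz0.le
    _ = L := by rw [← hLz, mul_div_cancel_right₀ _ hz0.ne']

/-! ### Conclusions: `G_n'(σ) ≥ 1` near `σ = 1` and `G_n(σ) ≥ (σ−1)/2 − C/log n` -/

/-- `π²/6 − 1/10 ≥ 3/2 + 1/25`: the numerical margin at `Φ'(1) = ζ(2) = π²/6`. [folklore] -/
theorem re_riemannZeta_two_ge : (38 : ℝ) / 25 + 1 / 10 ≤ (riemannZeta 2).re := by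
  rw [riemannZeta_two]
  have h : ((Real.pi : ℂ) ^ 2 / 6).re = Real.pi ^ 2 / 6 := by
    rw [show (Real.pi : ℂ) ^ 2 / 6 = ((Real.pi ^ 2 / 6 : ℝ) : ℂ) by push_cast; ring, Complex.ofReal_re]
  rw [h]
  nlinarith [Real.pi_gt_d2]

/-- **Turán's (5.7), uniform form: `G_n'(σ) = −∑_{ν ≤ n} λ(ν) log ν · ν^{−σ} ≥ 1` for all
`σ ∈ (1, 1 + a]` and all `n ≥ n₁`.** The full series equals `Φ'(σ) → Φ'(1) = ζ(2) = π²/6 > 3/2`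
(`σ → 1⁺`), and the tail is `≤ C/log n` uniformly. [cite: Turan1960, §5 (5.7)] -/
theorem exists_deriv_lower_bound :
    ∃ a : ℝ, 0 < a ∧ ∃ n₁ : ℕ, ∀ n : ℕ, n₁ ≤ n → ∀ σ : ℝ, 1 < σ → σ ≤ 1 + a →
      1 ≤ -∑ k ∈ Icc 1 n, Real.log k * (k : ℝ) ^ (-σ) * (liouville k : ℝ) := by
  -- continuity of `Φ'` at `1`
  obtain ⟨δ, hδ0, hδ⟩ := Metric.continuousAt_iff.1 continuousAt_deriv_Phi_one (1 / 10) (by norm_num)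
  obtain ⟨C, hC0, hC⟩ := abs_tails_le
  set a : ℝ := min (δ / 2) 1 with ha
  have ha0 : 0 < a := lt_min (by linarith) one_pos
  refine ⟨a, ha0, max 3 ⌈Real.exp (2 * C + 1)⌉₊, fun n hn σ hσ1 hσa ↦ ?_⟩
  have hn3 : 3 ≤ n := le_trans (le_max_left _ _) hn
  have hσ2 : σ ≤ 2 := by linarith [min_le_right (δ / 2) 1]
  have hσδ : dist (σ : ℂ) 1 < δ := by
    rw [Complex.dist_eq, show (σ : ℂ) - 1 = ((σ - 1 : ℝ) : ℂ) by push_cast; ring, Complex.norm_real,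
      Real.norm_eq_abs, abs_of_pos (by linarith)]
    linarith [min_le_left (δ / 2) 1]
  -- the full series
  set S : ℝ := ∑' k : ℕ, (Real.log k * (k : ℝ) ^ (-σ)) * (liouville k : ℝ) with hS
  have hSeq : (S : ℂ) = -deriv Phi σ := by
    rw [deriv_Phi_ofReal hσ1, neg_neg, LSeries_logMul_lam_ofReal σ]
  have hSre : S = -(deriv Phi σ).re := by
    have := congrArg Complex.re hSeq
    simpa using this
  have hderiv1 : deriv Phi 1 = riemannZeta 2 := hasDerivAt_Phi_one.deriv
  have hclose : (riemannZeta 2).re - 1 / 10 ≤ (deriv Phi σ).re := by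
    have h := hδ hσδ
    rw [hderiv1, Complex.dist_eq] at h
    have := (abs_re_le_norm (deriv Phi σ - riemannZeta 2)).trans h.le
    rw [Complex.sub_re, abs_le] at this
    linarith [this.1]
  -- the tail
  have htail : |S - ∑ k ∈ Icc 1 n, (Real.log k * (k : ℝ) ^ (-σ)) * (liouville k : ℝ)| ≤ C / Real.log n :=
    abs_tsum_sub_sum_Icc_le (summable_log_rpow_mul_liouville hσ1) (by simp)
      fun m hm ↦ (hC n m hn3 hm σ hσ1.le hσ2).2
  -- `C/log n ≤ 1/2`
  have hlogn : 2 * C + 1 ≤ Real.log n := by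
    have h1 : Real.exp (2 * C + 1) ≤ n := by
      have : (⌈Real.exp (2 * C + 1)⌉₊ : ℝ) ≤ n := by exact_mod_cast le_trans (le_max_right _ _) hn
      exact (Nat.le_ceil _).trans this
    have := Real.log_le_log (Real.exp_pos _) h1
    rwa [Real.log_exp] at this
  have hClog : C / Real.log n ≤ 1 / 2 := by
    rw [div_le_iff₀ (by linarith)]
    linarith
  have h38 := re_riemannZeta_two_ge
  have := (abs_le.1 htail).1
  linarith

/-- **`G_n(σ) ≥ (σ − 1)/2 − C/log n`** for `n ≥ 3`, `1 < σ ≤ 2`: the full series is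
`≥ (σ − 1)/σ ≥ (σ − 1)/2` and the tail is `≤ C/log n`. [cite: Turan1960, §5 (5.4)] -/
theorem exists_lower_bound :
    ∃ C : ℝ, 0 ≤ C ∧ ∀ n : ℕ, 3 ≤ n → ∀ σ : ℝ, 1 < σ → σ ≤ 2 →
      (σ - 1) / 2 - C / Real.log n ≤ ∑ k ∈ Icc 1 n, (k : ℝ) ^ (-σ) * (liouville k : ℝ) := by
  obtain ⟨C, hC0, hC⟩ := abs_tails_le
  refine ⟨C, hC0, fun n hn σ hσ1 hσ2 ↦ ?_⟩
  have hL := tsum_rpow_mul_liouville_ge hσ1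
  have htail : |(∑' k : ℕ, (k : ℝ) ^ (-σ) * (liouville k : ℝ)) -
      ∑ k ∈ Icc 1 n, (k : ℝ) ^ (-σ) * (liouville k : ℝ)| ≤ C / Real.log n :=
    abs_tsum_sub_sum_Icc_le (summable_rpow_mul_liouville hσ1)
      (by simp [Real.zero_rpow (by linarith : (-σ : ℝ) ≠ 0)])
      fun m hm ↦ (hC n m hn hm σ hσ1.le hσ2).1
  have h1 : (σ - 1) / 2 ≤ (σ - 1) / σ :=
    div_le_div_of_nonneg_left (by linarith) (by linarith) hσ2
  have := (abs_le.1 htail).2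
  linarith

end TuranLocal

end Literature.NumberTheory.LFunctions

end
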